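import Summits.Ventures.QEC.Theorems.BB144DistanceCertificateLowerZ
import Summits.Ventures.QEC.Census.BB.BB144.BZAutCoverTabZ
import HarnessLib

/-!
# `[[144,12,12]]` — the `bz_aut` lower bound modulo the block verdicts, with the KERNEL label cover

`Theorems/BB144DistanceCertificateLowerZ.lean` (qec-type-10) assembled the lower bound from the 15 representative
block replays with ONE `native_decide` (the label cover `coverAut_ok` by probing). qec-type-12 has since landed the
TABULATED cover `coverAutTabOK_bb144` (`Census/BB/BB144/BZAutCoverTabZ.lean`, `decide +kernel`, standard axioms) with
the same soundness shape (`coverAutTabOK_sound`). This file re-assembles the bound on that kernel cover: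
`lowerZ_of_blocks_kernel` / `twelve_le_of_blocks_kernel` have axioms ⊆ {propext, Classical.choice, Quot.sound}, so a
closer of item NoZLogicalBelowTwelve built on them is exactly as certified as the enumeration verdicts it imports
(KERNEL verdict files ⇒ KERNEL-std `[[144,12,12]]`, no other change). Everything else as in the sibling file.
-/

namespace Summit.Ventures.QEC.Census.BB144

open Matrix Literature.InformationTheory.QuantumCodes Literature.InformationTheory.QuantumCodes.BB
  Summit.Ventures.QEC.BB

/-- **The lower bound modulo the block verdicts, KERNEL cover**: as `lowerZ_of_blocks`, but the label cover is
type-12's TABULATED check `coverAutTabOK_bb144` (`decide +kernel`), so this theorem's axioms are the standard three —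
the tier of a closer built on it is decided by the enumeration verdicts alone. -/
theorem lowerZ_of_blocks_kernel (hblocks : ∀ b : ℕ, b < bzAutData.sideZ.blocks.length → cert.bzZBlock bzAutData b = true)
    (w : Fin cert.n → ZMod 2) (hw : rowMatrix cert.n cert.HX *ᵥ w = 0)
    (hw' : w ∉ rowSpace (rowMatrix cert.n cert.HZ)) : 11 < hammingNorm w := by
  -- structural facts unpacked once
  have hcore := core_ok
  simp only [bzCoreOK, Bool.and_eq_true, beq_iff_eq] at hcore
  obtain ⟨⟨⟨⟨hY, hS⟩, hL⟩, hdim⟩, -⟩ := hcore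
  -- the label-action ingredients
  have hLX : ∀ a, flatCode.HZ *ᵥ LXmat a = 0 := fun a => mulVec_dual_eq_zero hL a
  have hexp : ∀ z, flatCode.HX *ᵥ z = 0 → z - (LXmat *ᵥ z) ᵥ* LZmat ∈ flatCode.rowSpZ := fun z hz =>
    flatCode.sub_label_vecMul_mem_rowSpZ hLX LX_mul_LZ_transpose (exists_coeffs_of_ker comm_flat hY hS hL hdim hz)
  refine bzAut_lower_sound (s := bzAutData.sideZ) comm_flat foundZ_ok core_ok len_ok hblocks
    (α := {t : Mono 12 6 // (((t.1 : Fin 12) : ℕ), ((t.2 : Fin 6) : ℕ)) ∈ allTranslations})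
    (fun a z => z ∘ sigmaInv a.1)
    (fun a => LXmat * (LZmat.submatrix id (sigmaInv a.1))ᵀ)
    (fun a z hz hz' => ?_) (fun lam hlam => ?_) w hw hw'
  · -- transport by the translation `a.1`: row-map automorphism facts on the certificate's matrices
    have hXsub : flatCode.HX.submatrix (BB.checkTranslateFlat a.1) (BB.translateFlat a.1) = flatCode.HX := by
      have h := BB.HXFlat_submatrix_translateFlat BB.bb144 a.1
      rw [← HX_eq_flat] at h
      exact h
    have hZsub : flatCode.HZ.submatrix (BB.checkTranslateFlat a.1) (BB.translateFlat a.1) = flatCode.HZ := by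
      have h := BB.HZFlat_submatrix_translateFlat BB.bb144 a.1
      rw [← HZ_eq_flat] at h
      exact h
    obtain ⟨h1, h2⟩ := flatCode.zLogical_comp_equiv_symm_of_rowMap hXsub hZsub ⟨hz, hz'⟩
    exact ⟨h1, h2, hammingNorm_comp_equiv z (BB.translateFlat a.1 : Fin cert.n ≃ Fin cert.n),
      flatCode.label_comp_equiv_symm hLX hexp hZsub hz⟩
  · -- cover by translates
    rcases coverAutTabOK_sound (ℓ := 12) (m := 6) coverAutTabOK_bb144
        (P := fun μ => ∃ b : Fin bzAutData.sideZ.blocks.length, μ ∈ Submodule.span (ZMod 2)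
          (Set.range fun l : Fin (bzAutData.sideZ.blocks[b]).W.length =>
            ofBits bzAutData.LZ.length (bzAutData.sideZ.blocks[b]).W[l]))
        (fun v hv => testBit_coverMask_imp_exists_span _ _ hv)
        (Ld' := LXmat) (L' := LZmat) (fun i => rfl)
        (fun j => by
          change ofBits cert.n bzAutData.LZ[j] = ofBits cert.n (bzAutData.LZ.getD j 0)
          rw [List.getD_eq_getElem?_getD, List.getElem?_eq_getElem j.2, Option.getD_some]
          rfl)
        lam hlam with hP | ⟨t, ht, hPt⟩
    · exact Or.inl hP
    · obtain ⟨b, hb⟩ := hPt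
      exact Or.inr ⟨⟨t, ht⟩, b, hb⟩

/-- The bound on the TYPED code's flat matrices (`BB.bb144.HXFlat/HZFlat`), KERNEL cover: the shape type-12's
method-independent closers (`bb144_d_eq_of_forall_lt_flat`) and type-05's `zLowerBound_of_flat` consume. -/
theorem twelve_le_flat_of_blocks
    (hblocks : ∀ b : ℕ, b < bzAutData.sideZ.blocks.length → cert.bzZBlock bzAutData b = true)
    (w : Fin (12 * 6 + 12 * 6) → ZMod 2) (hw : BB.bb144.HXFlat *ᵥ w = 0) (hw' : w ∉ rowSpace BB.bb144.HZFlat) :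
    12 ≤ hammingNorm w := by
  rw [← HX_eq_flat] at hw
  rw [← HZ_eq_flat] at hw'
  exact lowerZ_of_blocks_kernel hblocks w hw hw'

end Summit.Ventures.QEC.Census.BB144
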